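import Summits.CriticalPhenomena.PercolationContinuityZ3.Theorems.Transplant.SkelFrmFromBParamsFaceOriginsXTA
import Summits.CriticalPhenomena.PercolationContinuityZ3.Theorems.Transplant.SkelFrmBParamsFaceOriginsXTA
import Summits.CriticalPhenomena.PercolationContinuityZ3.Theorems.Transplant.PlanarSkeletonFrmFromDefs
import Summits.CriticalPhenomena.PercolationContinuityZ3.Theorems.Transplant.PlanarSkeletonFrmDefs
import Summits.CriticalPhenomena.PercolationContinuityZ3.Theorems.Transplant.SkelPhiStepIDataNS
import HarnessLib
import Summits.CriticalPhenomena.PercolationContinuityZ3.Theorems.Transplant.SkelFrmBParamsFaceOriginsXLA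
/-!
# U-WAVE PORT (RULING D-U, lead g21 2026-08-26; WAVE-U-MANIFEST v3.1 row «SkelFrmBParamsFaceOriginsXLA» ↦ «SkelFrmFromBParamsFaceOriginsXLA») of the tree module
# `Transplant/SkelFrmBParamsFaceOriginsXLA` onto the carrier `PlanarSkeletonFrmFrom` (frames only, cylinders connected from width `ℓ₀` on)

ORIGINAL TITLE: (F) VALUE LAYER, N2 twin (hp-8 g42, 2026-08-23; F-DISCHARGE-MAP-N2 G18 x-face origins, the `|yL|₁ ≤ YbF` rows): `port_frm.py` text of N1

builds on p205010 (kernel theorem, internal audit signed; external expert review pending) — nothing in this file uses p205010; NOTHING is claimed about the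
OPEN node U `SamePDropOfSkeletonFrmFrom₁` (nor U_s / the end state).  Lane `prim-bschramm`, seat `prim-bschramm-stmt` gen 26 (port pen, RULING M-11 family P-stmt; tool = p3-g26's port_u.py of record, registry-driven inputs); helper file
(`--supports stmt-CriticalPhenomena-4575 --as helper`).  PORT RULES r1–r4 of RULING D-U: declaration order and proof texts are those of the original,
byte-identical except (i) the carrier token `PlanarSkeletonFrm ↦ PlanarSkeletonFrmFrom` (binders, `namespace`/`end` lines, qualified names of twinned
declarations), (ii) carrier-FREE declarations of the original (φ-level `Skelφ…` blocks and namespace-only arithmetic residents) are NOT re-declared —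
this file imports the original and `export`s the twin-free residents (POLICY T / treatment (m1)); residents whose statement mentions a twinned
constant are copied, (iii) every carrier-binding declaration keeps its explicit binder `(Φ : PlanarSkeletonFrmFrom G)` in its own signature (r2).  Docstrings and citations are the original's.
-/

noncomputable section

open scoped Classical

namespace Summit.CriticalPhenomena.PercolationContinuityZ3.Theorems.Transplant

namespace PlanarSkeletonFrmFrom

namespace NegB

open Literature.Probability.Percolation Literature.Probability.LatticeModels SimpleGraph
open SkelConc (Consts)
open Skelφ (shearUnit shearUnit_pos sgnz sgnz_cases)
open Skelφ.StepI (DataN)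
open Neg

namespace KS

section L1

/-- **`|yLXFs σ|₁ ≤ YbF`** (`|nBF| + |hBF| + ⌊(ℓ_L+ℓBF)/2⌋ ≤ S_F + ℓ_L`). [folklore] -/
theorem yLXFs_l1 (κ : Consts) {V : Type} [DecidableEq V] [Countable V] {G : SimpleGraph V} [G.LocallyFinite] (Φ : PlanarSkeletonFrmFrom G) (t : V) (p : unitInterval) (D : Skelφ.StepI.DataNS V) (c : ℕ) (mk : ℕ) (gx : Neg.FSlot) (fx : Neg.FSlot) {σ : ℤ} (hσ : σ = 1 ∨ σ = -1) :
    (yLXFs κ Φ t p D c mk (gT mk gx κ Φ t p D) (fT mk fx κ Φ t p D) σ 0).natAbs + (yLXFs κ Φ t p D c mk (gT mk gx κ Φ t p D) (fT mk fx κ Φ t p D) σ 1).natAbs ≤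
      YbF κ Φ t p D c mk (gT mk gx κ Φ t p D) (fT mk fx κ Φ t p D) := by
  have h : (yLXFs κ Φ t p D c mk (gT mk gx κ Φ t p D) (fT mk fx κ Φ t p D) σ 0).natAbs + (yLXFs κ Φ t p D c mk (gT mk gx κ Φ t p D) (fT mk fx κ Φ t p D) σ 1).natAbs ≤
      nL κ Φ t p D (gT mk gx κ Φ t p D) (fT mk fx κ Φ t p D) + (hL κ Φ t p D (gT mk gx κ Φ t p D) (fT mk fx κ Φ t p D)).natAbs + ((nBF κ Φ t p D c mk : ℕ) : ℤ).natAbs +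
        (hBF κ Φ t p D c mk).natAbs + (mhXFs κ Φ t p D c mk (gT mk gx κ Φ t p D) (fT mk fx κ Φ t p D)).natAbs :=
    yLof_l1 κ Φ t p D _ _ hσ _ _ _
  obtain ⟨m1, m2⟩ := PlanarSkeletonNeg.NegB.RootArith.floor_sandwich (x := (ℓL κ Φ t p D (gT mk gx κ Φ t p D) (fT mk fx κ Φ t p D) : ℤ) + ℓBF κ Φ t p D c mk) (d := 2) (by norm_num)
  have em : mhXFs κ Φ t p D c mk (gT mk gx κ Φ t p D) (fT mk fx κ Φ t p D) = ((ℓL κ Φ t p D (gT mk gx κ Φ t p D) (fT mk fx κ Φ t p D) : ℤ) + ℓBF κ Φ t p D c mk) / 2 := rfl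
  rw [← em] at m1 m2
  have k1 : (((mhXFs κ Φ t p D c mk (gT mk gx κ Φ t p D) (fT mk fx κ Φ t p D)).natAbs : ℕ) : ℤ) ≤ (ℓL κ Φ t p D (gT mk gx κ Φ t p D) (fT mk fx κ Φ t p D) : ℤ) + ℓBF κ Φ t p D c mk := by
    rw [Int.natCast_natAbs, abs_of_nonneg (by omega)]; omega
  rw [Int.natAbs_natCast] at h
  have e : ((nL κ Φ t p D (gT mk gx κ Φ t p D) (fT mk fx κ Φ t p D) + (hL κ Φ t p D (gT mk gx κ Φ t p D) (fT mk fx κ Φ t p D)).natAbs + nBF κ Φ t p D c mk +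
        (hBF κ Φ t p D c mk).natAbs + (mhXFs κ Φ t p D c mk (gT mk gx κ Φ t p D) (fT mk fx κ Φ t p D)).natAbs : ℕ) : ℤ) ≤
      ((YbF κ Φ t p D c mk (gT mk gx κ Φ t p D) (fT mk fx κ Φ t p D) : ℕ) : ℤ) := by
    unfold YbF SF; push_cast [Int.natCast_natAbs] at k1 ⊢
    linarith [abs_nonneg (hL κ Φ t p D (gT mk gx κ Φ t p D) (fT mk fx κ Φ t p D)), abs_nonneg (hBF κ Φ t p D c mk)]
  exact h.trans (by exact_mod_cast e)

/-- **`|yLXFd σ|₁ ≤ YbF`** (`|d0XFd| ≤ |hBF| + ℓBF`, `|sgnz hBF · nBF| = nBF`, `⌊ℓ_L/2⌋ ≤ ℓ_L`). [folklore] -/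
theorem yLXFd_l1 (κ : Consts) {V : Type} [DecidableEq V] [Countable V] {G : SimpleGraph V} [G.LocallyFinite] (Φ : PlanarSkeletonFrmFrom G) (t : V) (p : unitInterval) (D : Skelφ.StepI.DataNS V) (c : ℕ) (mk : ℕ) (gx : Neg.FSlot) (fx : Neg.FSlot) {σ : ℤ} (hσ : σ = 1 ∨ σ = -1) :
    (yLXFd κ Φ t p D c mk (gT mk gx κ Φ t p D) (fT mk fx κ Φ t p D) σ 0).natAbs + (yLXFd κ Φ t p D c mk (gT mk gx κ Φ t p D) (fT mk fx κ Φ t p D) σ 1).natAbs ≤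
      YbF κ Φ t p D c mk (gT mk gx κ Φ t p D) (fT mk fx κ Φ t p D) := by
  have h : (yLXFd κ Φ t p D c mk (gT mk gx κ Φ t p D) (fT mk fx κ Φ t p D) σ 0).natAbs + (yLXFd κ Φ t p D c mk (gT mk gx κ Φ t p D) (fT mk fx κ Φ t p D) σ 1).natAbs ≤
      nL κ Φ t p D (gT mk gx κ Φ t p D) (fT mk fx κ Φ t p D) + (hL κ Φ t p D (gT mk gx κ Φ t p D) (fT mk fx κ Φ t p D)).natAbs + (d0XFd κ Φ t p D c mk).natAbs +
        (sgnz (hBF κ Φ t p D c mk) * (nBF κ Φ t p D c mk : ℤ)).natAbs + ((ℓL κ Φ t p D (gT mk gx κ Φ t p D) (fT mk fx κ Φ t p D) : ℤ) / 2).natAbs :=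
    yLof_l1 κ Φ t p D _ _ hσ _ _ _
  obtain ⟨d1, d2⟩ := PlanarSkeletonNeg.NegB.RootArith.floor_sandwich (x := 2 * |hBF κ Φ t p D c mk| + (ℓBF κ Φ t p D c mk : ℤ)) (d := 2) (by norm_num)
  have ed : d0XFd κ Φ t p D c mk = (2 * |hBF κ Φ t p D c mk| + (ℓBF κ Φ t p D c mk : ℤ)) / 2 := rfl
  rw [← ed] at d1 d2
  obtain ⟨l1, l2⟩ := PlanarSkeletonNeg.NegB.RootArith.floor_sandwich (x := (ℓL κ Φ t p D (gT mk gx κ Φ t p D) (fT mk fx κ Φ t p D) : ℤ)) (d := 2) (by norm_num)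
  have hs : |sgnz (hBF κ Φ t p D c mk)| = 1 := by rcases sgnz_cases (hBF κ Φ t p D c mk) with h | h <;> simp [h]
  have k1 : (((d0XFd κ Φ t p D c mk).natAbs : ℕ) : ℤ) ≤ |hBF κ Φ t p D c mk| + ℓBF κ Φ t p D c mk := by
    rw [Int.natCast_natAbs, abs_of_nonneg (by linarith [abs_nonneg (hBF κ Φ t p D c mk)])]; linarith [abs_nonneg (hBF κ Φ t p D c mk)]
  have k2 : (((sgnz (hBF κ Φ t p D c mk) * (nBF κ Φ t p D c mk : ℤ)).natAbs : ℕ) : ℤ) = nBF κ Φ t p D c mk := by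
    rw [Int.natCast_natAbs, abs_mul, hs, one_mul, Nat.abs_cast]
  have k3 : ((((ℓL κ Φ t p D (gT mk gx κ Φ t p D) (fT mk fx κ Φ t p D) : ℤ) / 2).natAbs : ℕ) : ℤ) ≤ ℓL κ Φ t p D (gT mk gx κ Φ t p D) (fT mk fx κ Φ t p D) := by
    rw [Int.natCast_natAbs, abs_of_nonneg (by omega)]; omega
  have e : ((nL κ Φ t p D (gT mk gx κ Φ t p D) (fT mk fx κ Φ t p D) + (hL κ Φ t p D (gT mk gx κ Φ t p D) (fT mk fx κ Φ t p D)).natAbs + (d0XFd κ Φ t p D c mk).natAbs +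
        (sgnz (hBF κ Φ t p D c mk) * (nBF κ Φ t p D c mk : ℤ)).natAbs + ((ℓL κ Φ t p D (gT mk gx κ Φ t p D) (fT mk fx κ Φ t p D) : ℤ) / 2).natAbs : ℕ) : ℤ) ≤
      ((YbF κ Φ t p D c mk (gT mk gx κ Φ t p D) (fT mk fx κ Φ t p D) : ℕ) : ℤ) := by
    unfold YbF SF; push_cast [Int.natCast_natAbs] at k1 k2 k3 ⊢
    linarith [abs_nonneg (hL κ Φ t p D (gT mk gx κ Φ t p D) (fT mk fx κ Φ t p D)), abs_nonneg (hBF κ Φ t p D c mk)]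
  exact h.trans (by exact_mod_cast e)

/-- **`|yLXFt σ|₁ ≤ YbF`** (`|ℓBF − 5| ≤ ℓBF + 5`, `⌊ℓ_L/2⌋ ≤ ℓ_L`). [folklore] -/
theorem yLXFt_l1 (κ : Consts) {V : Type} [DecidableEq V] [Countable V] {G : SimpleGraph V} [G.LocallyFinite] (Φ : PlanarSkeletonFrmFrom G) (t : V) (p : unitInterval) (D : Skelφ.StepI.DataNS V) (c : ℕ) (mk : ℕ) (gx : Neg.FSlot) (fx : Neg.FSlot) {σ : ℤ} (hσ : σ = 1 ∨ σ = -1) :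
    (yLXFt κ Φ t p D c mk (gT mk gx κ Φ t p D) (fT mk fx κ Φ t p D) σ 0).natAbs + (yLXFt κ Φ t p D c mk (gT mk gx κ Φ t p D) (fT mk fx κ Φ t p D) σ 1).natAbs ≤
      YbF κ Φ t p D c mk (gT mk gx κ Φ t p D) (fT mk fx κ Φ t p D) := by
  have h : (yLXFt κ Φ t p D c mk (gT mk gx κ Φ t p D) (fT mk fx κ Φ t p D) σ 0).natAbs + (yLXFt κ Φ t p D c mk (gT mk gx κ Φ t p D) (fT mk fx κ Φ t p D) σ 1).natAbs ≤
      nL κ Φ t p D (gT mk gx κ Φ t p D) (fT mk fx κ Φ t p D) + (hL κ Φ t p D (gT mk gx κ Φ t p D) (fT mk fx κ Φ t p D)).natAbs + ((ℓBF κ Φ t p D c mk : ℤ) - 5).natAbs +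
        (0 : ℤ).natAbs + ((ℓL κ Φ t p D (gT mk gx κ Φ t p D) (fT mk fx κ Φ t p D) : ℤ) / 2).natAbs :=
    yLof_l1 κ Φ t p D _ _ hσ _ _ _
  obtain ⟨l1, l2⟩ := PlanarSkeletonNeg.NegB.RootArith.floor_sandwich (x := (ℓL κ Φ t p D (gT mk gx κ Φ t p D) (fT mk fx κ Φ t p D) : ℤ)) (d := 2) (by norm_num)
  have k1 : ((((ℓBF κ Φ t p D c mk : ℤ) - 5).natAbs : ℕ) : ℤ) ≤ (ℓBF κ Φ t p D c mk : ℤ) + 5 := by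
    rw [Int.natCast_natAbs]; exact abs_le.2 ⟨by linarith, by linarith⟩
  have k3 : ((((ℓL κ Φ t p D (gT mk gx κ Φ t p D) (fT mk fx κ Φ t p D) : ℤ) / 2).natAbs : ℕ) : ℤ) ≤ ℓL κ Φ t p D (gT mk gx κ Φ t p D) (fT mk fx κ Φ t p D) := by
    rw [Int.natCast_natAbs, abs_of_nonneg (by omega)]; omega
  have e : ((nL κ Φ t p D (gT mk gx κ Φ t p D) (fT mk fx κ Φ t p D) + (hL κ Φ t p D (gT mk gx κ Φ t p D) (fT mk fx κ Φ t p D)).natAbs + ((ℓBF κ Φ t p D c mk : ℤ) - 5).natAbs +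
        (0 : ℤ).natAbs + ((ℓL κ Φ t p D (gT mk gx κ Φ t p D) (fT mk fx κ Φ t p D) : ℤ) / 2).natAbs : ℕ) : ℤ) ≤
      ((YbF κ Φ t p D c mk (gT mk gx κ Φ t p D) (fT mk fx κ Φ t p D) : ℕ) : ℤ) := by
    unfold YbF SF; push_cast [Int.natCast_natAbs] at k1 k3 ⊢; simp only [add_zero]
    linarith [abs_nonneg (hL κ Φ t p D (gT mk gx κ Φ t p D) (fT mk fx κ Φ t p D)), abs_nonneg (hBF κ Φ t p D c mk)]
  exact h.trans (by exact_mod_cast e)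

end L1

end KS

end NegB

end PlanarSkeletonFrmFrom

end Summit.CriticalPhenomena.PercolationContinuityZ3.Theorems.Transplant

end
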